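import Literature.NumberTheory.Automorphic.UnitaryGroupSingularHeisenbergFibre
import Literature.NumberTheory.Automorphic.UnitaryGroupTraceZeroLine
import Literature.NumberTheory.Automorphic.UnitaryGroupHeisenbergCentreLatticeUnfolding
import Literature.NumberTheory.Automorphic.UnitaryGroupSingularBracket
import Literature.NumberTheory.Automorphic.UnitaryGroupKernelClassUnipotent
import Literature.NumberTheory.Automorphic.UnitaryGroupTorusCentreUnfolding
import Literature.NumberTheory.Automorphic.UnitaryGroupBorelModulusThree
import Literature.NumberTheory.Automorphic.IdeleClassIntegration
import Literature.NumberTheory.AdelicBaseChange.IdeleNormModule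
import HarnessLib

/-!
# The centre-lattice sum of the unipotent term of `U(J₃)`: invariances, the torus dilation read on the
# line `𝔸_F · δ`, and its `K`-average as a lattice sum over `F^*` of a norm profile
(Rogawski, *Automorphic Representations of Unitary Groups in Three Variables* (1990), §7.3, proof of
Prop. 7.3.2, (7.3.2)–(7.3.3), pp. 96–97: the term `Σ_{w ∈ E⁰, w ≠ 0} f(g⁻¹ γ n(w) g)` of the unipotent class sum,
on which «`M` acts on `n(w)` through `α₃(m)⁻¹ = N_{E/F}(a)⁻¹`», so that after the Iwasawa decomposition it is
the integral over `ZM∖M` of `Σ_{t ∈ F^*} Φ(t · N(a))`; §7.2 p. 94 for the identification `E⁰ = F δ₀`.)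

Topic `NumberTheory/Automorphic`; namespace `Literature.NumberTheory.Automorphic.UnitaryGroup`. THEOREMS ONLY
over accepted tree modules (no definition, no named fact, no instance, no notation, no `sorry`). Row (C-K)
«TORUS INTEGRAND OF THE CENTRE LATTICE SUM» of piece (C) «centre-lattice part `P_{z·𝒰}`» of the unipotent
term on the LAW 5 road of `Cruxes/H413/Lines/F0_T1InnerFormTraceIdentity.lean` (crux H413; cell hodgecm-mathlib;
B-p10 (g19) sub-cut 2026-08-31T13:14Z). Letters (★ B1 `UnitaryGroupTruncatedTraceClassUnipotentUnfold`, ★ (E0)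
`UnitaryGroupRationalHeisenbergSplit`, ★ (C-P) `UnitaryGroupTorusCentreUnfolding`): `z ∈ E¹` as
`ζ : ratOne F E c`, `z₁ ∈ G(F)` with `↑z₁ = toAdelic (z · 1)`; `n(y) := heisChart hc (0, y)` the centre of the
Heisenberg group `N(𝔸_F)`; the lattice `E⁻ = rationalTraceZero F E c`; the CENTRE LATTICE SUM, spelled inline,

  `ψᶜ_G(g) := Σ'_{w ∈ E⁻, w ≠ 0} G(g⁻¹ · (z₁ n(w)) · g)`;

the line `θ = traceZeroLine F E c hcδ hδ : 𝔸_F ≃ 𝔸_E⁻`, `t ↦ (t ⊗ 1) δ` (★ `UnitaryGroupTraceZeroLine`); the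
relative norm `N = AdeleRing.ideleRelNorm F E`; `d₀ t = diagUnit (↑t).2 0` the first diagonal entry of
`t ∈ T(𝔸_F) = torusInBorel F E c 3`.

* §1 (K1) INVARIANCES: `ψᶜ_G(n g) = ψᶜ_G(g)` for every `n ∈ N(𝔸_F)` (`n(w)` is central in `N`, `z₁` central in
  `G`) — `tsum_centre_conj_unipotent_mul`; `ψᶜ_G(b g) = ψᶜ_G(g)` for `b ∈ B(F)` (conjugation by `b` dilates the
  centre by the PRINCIPAL `c`-fixed scalar `d₀⁻¹ d₂`, which permutes `E⁻ ∖ 0`) — `tsum_centre_conj_borel_mul`;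
  measurability `measurable_tsum_centre`.
* §2 (K-torus) THE TORUS DILATES THE CENTRE VARIABLE: `ψᶜ_G(t g) = Σ'_{w ≠ 0} G(g⁻¹ (z₁ n(a_t w)) g)`,
  `a_t = d₀⁻¹ d₂` (★ A-p14 `torus_inv_mul_center_mul_torus`) — `tsum_centre_conj_torus_mul`; for `E/F` quadratic,
  `a_t = ((N d₀)⁻¹ ⊗ 1)` (`inv_mul_diagUnit_two_eq_ideleBaseChange`) and, re-indexing `E⁻ ∖ 0 = θ(F^*)` by the
  principal ideles, **`ψᶜ_G(t g) = Σ'_{k ∈ F^*} G(g⁻¹ (z₁ n(θ((k · N d₀ t)⁻¹))) g)`**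
  (`tsum_centre_conj_torus_mul_eq_tsum_principalIdeles`) — Rogawski's «`M` acts through `α₃(m)⁻¹`».
* §3 (K4) `δ_B(t) = ‖N(d₀ t)‖_F²` (`torusRootModulus_diagUnit_eq_ideleNorm_ideleRelNorm_sq`; ★
  `torusRootModulus_three_eq`, Tate's Lemma 4.1.2 ★ `AdeleRing.distribHaarChar_eq_ideleNorm`, `‖N x‖_F = ‖x‖_E`).

Sequel (K2, analytic half: the `K`-average `∫_K ψᶜ_f(t k) dμK = Σ'_{k ∈ F^*} Φ_f(k · N(d₀ t))` with the norm profile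
`Φ_f(y) = ∫_K f(k⁻¹ (z₁ n(θ(y⁻¹))) k) dμK`, measurability): `UnitaryGroupTorusCentreLatticeKAverage`.

HC_CM is proved only modulo the 7 printed citations until rung 0 closes — nothing here bears on a summit statement.

## References
* J. D. Rogawski, *Automorphic Representations of Unitary Groups in Three Variables*, Ann. of Math. Stud. 123
  (1990), §1.10, §2.2 (p. 13), §7.2 (p. 94), §7.3 Prop. 7.3.2 (pp. 96–97) [Rogawski1990].
* J. W. S. Cassels, A. Fröhlich (eds.), *Algebraic Number Theory* (1967), Ch. II §11, Ch. XV (Tate) Lemma 4.1.2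
  [CasselsFrohlichANT1967].
* S. Gelbart, *Automorphic Forms on Adele Groups*, Ann. of Math. Stud. 83 (1975), (9.20) [Gelbart1975].
-/

set_option autoImplicit false

noncomputable section

open MeasureTheory Measure NumberField IsDedekindDomain Topology Set
open scoped MatrixGroups NNReal ENNReal

namespace Literature.NumberTheory.Automorphic

namespace UnitaryGroup

variable {F E : Type} [Field F] [NumberField F] [Field E] [NumberField E] [Algebra F E]
  {c : E ≃ₐ[F] E}

variable (ζ : ratOne F E c) {z₁ : (quasiSplit F E c 3).arithmeticSubgroup}

/-! ## §0 Conjugation plumbing -/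

section Plumbing

/-- `(x g)⁻¹ (z m) (x g) = g⁻¹ (z (x⁻¹ m x)) g` for `z` central. [folklore] -/
private theorem conj_mul_of_central {z : (quasiSplit F E c 3).Adelic}
    (hz : ∀ y : (quasiSplit F E c 3).Adelic, z * y = y * z) (x m g : (quasiSplit F E c 3).Adelic) :
    (x * g)⁻¹ * (z * m) * (x * g) = g⁻¹ * (z * (x⁻¹ * m * x)) * g := by
  have h : x⁻¹ * (z * m) * x = z * (x⁻¹ * m * x) := by
    rw [← mul_assoc x⁻¹, ← hz x⁻¹]
    simp only [mul_assoc]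
  calc (x * g)⁻¹ * (z * m) * (x * g) = g⁻¹ * (x⁻¹ * (z * m) * x) * g := by group
    _ = g⁻¹ * (z * (x⁻¹ * m * x)) * g := by rw [h]

/-- `z₁` is central: `z₁ y = y z₁`. [cite: Rogawski1990, §2.2 (p. 13)] -/
theorem coe_center_mul_comm
    (hz₁ : (z₁ : (quasiSplit F E c 3).Adelic) =
      (quasiSplit F E c 3).toAdelic (ratCenter F E c 3 ((StdForm.antidiagonal 3).over E) ζ))
    (y : (quasiSplit F E c 3).Adelic) :
    (z₁ : (quasiSplit F E c 3).Adelic) * y = y * (z₁ : (quasiSplit F E c 3).Adelic) := by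
  rw [hz₁]; exact toAdelic_ratCenter_mul_comm ζ y

end Plumbing

/-! ## §1 (K1) Invariances of the centre lattice sum -/

section Invariance

variable {M : Type*} [AddCommMonoid M] [TopologicalSpace M]

/-- **`N(𝔸_F)`-INVARIANCE of the centre lattice sum**: for every `n ∈ N(𝔸_F)` and `g ∈ G(𝔸_F)`,
`Σ'_{w ≠ 0} G((n g)⁻¹ (z₁ n(w)) (n g)) = Σ'_{w ≠ 0} G(g⁻¹ (z₁ n(w)) g)` — termwise: `n(w)` is central in `N(𝔸_F)`
(★ `commute_center_coe_unipotentInBorel`) and `z₁` is central in `G(𝔸_F)`. This is the left-`N(𝔸)`-invariance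
by which the centre term needs no `N(F)∖N(𝔸)`-unfolding («`m(N∖𝐍) = 1`»). [cite: Rogawski1990, §7.3 Prop. 7.3.2 (p. 96)] -/
theorem tsum_centre_conj_unipotent_mul (hc : c * c = 1)
    (hz₁ : (z₁ : (quasiSplit F E c 3).Adelic) =
      (quasiSplit F E c 3).toAdelic (ratCenter F E c 3 ((StdForm.antidiagonal 3).over E) ζ))
    (G : (quasiSplit F E c 3).Adelic → M) (n : unipotentInBorel F E c 3) (g : (quasiSplit F E c 3).Adelic) :
    (∑' w : {w : rationalTraceZero F E c // w ≠ 0},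
      G ((((n : borelAdelic F E c 3) : (quasiSplit F E c 3).Adelic) * g)⁻¹ *
        ((z₁ : (quasiSplit F E c 3).Adelic) *
          ((heisChart hc ((0 : AdeleRing (𝓞 E) E), ((w.1 : rationalTraceZero F E c) : traceZeroAdele F E c)) :
            adelicUnipotent F E c 3) : (quasiSplit F E c 3).Adelic)) *
        ((((n : borelAdelic F E c 3) : (quasiSplit F E c 3).Adelic)) * g))) =
      ∑' w : {w : rationalTraceZero F E c // w ≠ 0},
        G (g⁻¹ * ((z₁ : (quasiSplit F E c 3).Adelic) *
          ((heisChart hc ((0 : AdeleRing (𝓞 E) E), ((w.1 : rationalTraceZero F E c) : traceZeroAdele F E c)) :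
            adelicUnipotent F E c 3) : (quasiSplit F E c 3).Adelic)) * g) := by
  refine tsum_congr fun w => congrArg G ?_
  rw [conj_mul_of_central (coe_center_mul_comm ζ hz₁), coe_heisChart]
  congr 3
  have hcomm := (commute_center_coe_unipotentInBorel hc ((w.1 : rationalTraceZero F E c) : traceZeroAdele F E c) n).eq
  rw [mul_assoc, hcomm, inv_mul_cancel_left]

/-- **Conjugation by `b = t u ∈ B(𝔸_F)` dilates the centre: `(t u)⁻¹ n(w) (t u) = n(a_t · w)`**, `a_t = d₀⁻¹ d₂` the centre
character of the torus part (★ `torus_inv_mul_center_mul_torus`; `n(w)` is central in `N(𝔸_F)`). [cite: Rogawski1990, §1.10]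
[cite: Rogawski1990, §7.2 (p. 94)] -/
theorem torus_unipotent_inv_mul_center_mul (hc : c * c = 1) (t : torusInBorel F E c 3) (u : unipotentInBorel F E c 3)
    {d : Fin 3 → (AdeleRing (𝓞 E) E)ˣ}
    (hd : glDiagonal 3 (AdeleRing (𝓞 E) E) d =
      adelicVal F E c 3 _ ((t : borelAdelic F E c 3) : (quasiSplit F E c 3).Adelic))
    (w : traceZeroAdele F E c) :
    (((t : borelAdelic F E c 3) : (quasiSplit F E c 3).Adelic) * ((u : borelAdelic F E c 3) : (quasiSplit F E c 3).Adelic))⁻¹ *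
        ((heisChart hc ((0 : AdeleRing (𝓞 E) E), w) : adelicUnipotent F E c 3) : (quasiSplit F E c 3).Adelic) *
        (((t : borelAdelic F E c 3) : (quasiSplit F E c 3).Adelic) * ((u : borelAdelic F E c 3) : (quasiSplit F E c 3).Adelic)) =
      ((heisChart hc ((0 : AdeleRing (𝓞 E) E),
          smulTraceZero ((d 0)⁻¹ * d 2) (conjAdele_torusCentralScalar t hd) w) : adelicUnipotent F E c 3) :
        (quasiSplit F E c 3).Adelic) := by
  have hcomm := (commute_center_coe_unipotentInBorel hc
    (smulTraceZero ((d 0)⁻¹ * d 2) (conjAdele_torusCentralScalar t hd) w) u).eq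
  rw [coe_heisChart, coe_heisChart, _root_.mul_inv_rev]
  calc (((u : borelAdelic F E c 3) : (quasiSplit F E c 3).Adelic))⁻¹ *
        (((t : borelAdelic F E c 3) : (quasiSplit F E c 3).Adelic))⁻¹ *
        (((heisElt hc 0 w : unipotentInBorel F E c 3) : borelAdelic F E c 3) : (quasiSplit F E c 3).Adelic) *
        (((t : borelAdelic F E c 3) : (quasiSplit F E c 3).Adelic) * ((u : borelAdelic F E c 3) : (quasiSplit F E c 3).Adelic))
      = (((u : borelAdelic F E c 3) : (quasiSplit F E c 3).Adelic))⁻¹ *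
          ((((t : borelAdelic F E c 3) : (quasiSplit F E c 3).Adelic))⁻¹ *
            (((heisElt hc 0 w : unipotentInBorel F E c 3) : borelAdelic F E c 3) : (quasiSplit F E c 3).Adelic) *
            ((t : borelAdelic F E c 3) : (quasiSplit F E c 3).Adelic)) *
          ((u : borelAdelic F E c 3) : (quasiSplit F E c 3).Adelic) := by group
    _ = (((u : borelAdelic F E c 3) : (quasiSplit F E c 3).Adelic))⁻¹ *
          (((heisElt hc 0 (smulTraceZero ((d 0)⁻¹ * d 2) (conjAdele_torusCentralScalar t hd) w) :
            unipotentInBorel F E c 3) : borelAdelic F E c 3) : (quasiSplit F E c 3).Adelic) *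
          ((u : borelAdelic F E c 3) : (quasiSplit F E c 3).Adelic) := by
        rw [torus_inv_mul_center_mul_torus hc t hd w]
    _ = (((heisElt hc 0 (smulTraceZero ((d 0)⁻¹ * d 2) (conjAdele_torusCentralScalar t hd) w) :
            unipotentInBorel F E c 3) : borelAdelic F E c 3) : (quasiSplit F E c 3).Adelic) := by
        rw [mul_assoc, hcomm, inv_mul_cancel_left]

omit [NumberField F] in
/-- **A principal `c`-fixed idele permutes the non-zero lattice points**: for `λ = (η)_E` principal with `c λ = λ`,
`w ↦ λ w` is a bijection of `E⁻ ∖ 0` (★ `smulTraceZero_mem_rationalTraceZero` and its inverse). [cite: Rogawski1990, §1.10] -/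
theorem exists_equiv_rationalTraceZero_ne_zero_smulTraceZero (l : (AdeleRing (𝓞 E) E)ˣ) {η : E}
    (hlη : (l : AdeleRing (𝓞 E) E) = algebraMap E (AdeleRing (𝓞 E) E) η)
    (hl : conjAdele F E c (l : AdeleRing (𝓞 E) E) = l) :
    ∃ e : {w : rationalTraceZero F E c // w ≠ 0} ≃ {w : rationalTraceZero F E c // w ≠ 0},
      ∀ w, (((e w).1 : rationalTraceZero F E c) : traceZeroAdele F E c) =
        smulTraceZero l hl ((w.1 : rationalTraceZero F E c) : traceZeroAdele F E c) := by
  -- the equivalence on the lattice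
  let e₀ : rationalTraceZero F E c ≃ rationalTraceZero F E c :=
    { toFun := fun w => ⟨smulTraceZero l hl w, smulTraceZero_mem_rationalTraceZero l hlη hl w.2⟩
      invFun := fun w => ⟨smulTraceZero l⁻¹ (conjAdele_units_inv_of_fixed l hl) w,
        smulTraceZero_inv_mem_rationalTraceZero l hlη hl w.2⟩
      left_inv := fun w => Subtype.ext ((smulTraceZero l hl).symm_apply_apply w)
      right_inv := fun w => Subtype.ext ((smulTraceZero l hl).apply_symm_apply w) }
  have he₀ : ∀ w : rationalTraceZero F E c, ((e₀ w : rationalTraceZero F E c) : traceZeroAdele F E c) =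
      smulTraceZero l hl (w : traceZeroAdele F E c) := fun w => rfl
  have hne : ∀ w : rationalTraceZero F E c, e₀ w ≠ 0 ↔ w ≠ 0 := by
    intro w
    refine not_congr ⟨fun h => ?_, fun h => ?_⟩
    · have h' : smulTraceZero l hl (w : traceZeroAdele F E c) = 0 := by
        rw [← he₀, h]; rfl
      exact Subtype.ext ((map_eq_zero_iff _ (smulTraceZero l hl).injective).1 h')
    · refine Subtype.ext ?_
      rw [he₀, h]
      exact map_zero _
  exact ⟨e₀.subtypeEquiv fun w => (hne w).symm, fun w => he₀ w.1⟩

/-- **`B(F)`-INVARIANCE of the centre lattice sum**: for `b ∈ B(F)` (the rational Borel inside `G(F)`) and `g ∈ G(𝔸_F)`,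
`Σ'_{w ≠ 0} G((b g)⁻¹ (z₁ n(w)) (b g)) = Σ'_{w ≠ 0} G(g⁻¹ (z₁ n(w)) g)`: `b⁻¹ n(w) b = n(a_b w)` with `a_b = d₀⁻¹ d₂` PRINCIPAL
(★ `diagUnit_mem_principalIdeles_of_mem_arithmeticSubgroup`) and `c`-fixed, so `w ↦ a_b w` permutes `E⁻ ∖ 0` and the sum is
re-indexed (Mathlib `Equiv.tsum_eq`). [cite: Rogawski1990, §7.3 Prop. 7.3.2 (p. 96)] [cite: Rogawski1990, Prop. 7.2.1 (pp. 91–92)] -/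
theorem tsum_centre_conj_borel_mul (hc : c * c = 1)
    (hz₁ : (z₁ : (quasiSplit F E c 3).Adelic) =
      (quasiSplit F E c 3).toAdelic (ratCenter F E c 3 ((StdForm.antidiagonal 3).over E) ζ))
    (G : (quasiSplit F E c 3).Adelic → M) (b : (quasiSplit F E c 3).arithmeticSubgroup)
    (hb : b ∈ arithmeticBorel F E c 3) (g : (quasiSplit F E c 3).Adelic) :
    (∑' w : {w : rationalTraceZero F E c // w ≠ 0},
      G (((b : (quasiSplit F E c 3).Adelic) * g)⁻¹ *
        ((z₁ : (quasiSplit F E c 3).Adelic) *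
          ((heisChart hc ((0 : AdeleRing (𝓞 E) E), ((w.1 : rationalTraceZero F E c) : traceZeroAdele F E c)) :
            adelicUnipotent F E c 3) : (quasiSplit F E c 3).Adelic)) *
        ((b : (quasiSplit F E c 3).Adelic) * g))) =
      ∑' w : {w : rationalTraceZero F E c // w ≠ 0},
        G (g⁻¹ * ((z₁ : (quasiSplit F E c 3).Adelic) *
          ((heisChart hc ((0 : AdeleRing (𝓞 E) E), ((w.1 : rationalTraceZero F E c) : traceZeroAdele F E c)) :
            adelicUnipotent F E c 3) : (quasiSplit F E c 3).Adelic)) * g) := by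
  have hbB : (b : (quasiSplit F E c 3).Adelic) ∈ borelAdelic F E c 3 := (mem_arithmeticBorel_iff b).1 hb
  set B : borelAdelic F E c 3 := ⟨(b : (quasiSplit F E c 3).Adelic), hbB⟩ with hBdef
  -- the centre character `a = d₀⁻¹ d₂` of `b`: principal and `c`-fixed
  set t : torusInBorel F E c 3 := ⟨torusPart B, (mem_torusInBorel_iff _).2 (torusPart_mem_torusAdelic B)⟩ with ht
  have hd : glDiagonal 3 (AdeleRing (𝓞 E) E) (diagUnit B.2) =
      adelicVal F E c 3 _ ((t : borelAdelic F E c 3) : (quasiSplit F E c 3).Adelic) := (adelicVal_torusPart B).symm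
  have hfix : conjAdele F E c ((((diagUnit B.2 0)⁻¹ * diagUnit B.2 2 : (AdeleRing (𝓞 E) E)ˣ)) : AdeleRing (𝓞 E) E) =
      (((diagUnit B.2 0)⁻¹ * diagUnit B.2 2 : (AdeleRing (𝓞 E) E)ˣ) : AdeleRing (𝓞 E) E) :=
    conjAdele_torusCentralScalar t hd
  obtain ⟨η₀, hη₀⟩ := diagUnit_mem_principalIdeles_of_mem_arithmeticSubgroup hbB b.2 0
  obtain ⟨η₂, hη₂⟩ := diagUnit_mem_principalIdeles_of_mem_arithmeticSubgroup hbB b.2 2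
  have hlη : ((((diagUnit B.2 0)⁻¹ * diagUnit B.2 2 : (AdeleRing (𝓞 E) E)ˣ)) : AdeleRing (𝓞 E) E) =
      algebraMap E (AdeleRing (𝓞 E) E) ((η₀⁻¹ * η₂ : Eˣ) : E) := by
    have h0 : diagUnit B.2 0 = diagUnit hbB 0 := rfl
    have h2 : diagUnit B.2 2 = diagUnit hbB 2 := rfl
    rw [h0, h2, ← hη₀, ← hη₂, ← map_inv, ← map_mul, Units.coe_map, MonoidHom.coe_coe]
  obtain ⟨e, he⟩ := exists_equiv_rationalTraceZero_ne_zero_smulTraceZero (F := F) (c := c) _ hlη hfix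
  -- `b = t u`
  set u : unipotentInBorel F E c 3 := ⟨(torusPart B)⁻¹ * B, torusPart_inv_mul_mem_adelicUnipotent B⟩ with hu
  have hbtu : (b : (quasiSplit F E c 3).Adelic) =
      ((t : borelAdelic F E c 3) : (quasiSplit F E c 3).Adelic) * ((u : borelAdelic F E c 3) : (quasiSplit F E c 3).Adelic) := by
    rw [← Subgroup.coe_mul, mul_inv_cancel_left]
  have hconj : ∀ w' : traceZeroAdele F E c,
      ((b : (quasiSplit F E c 3).Adelic))⁻¹ *
          ((heisChart hc ((0 : AdeleRing (𝓞 E) E), w') : adelicUnipotent F E c 3) : (quasiSplit F E c 3).Adelic) *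
          (b : (quasiSplit F E c 3).Adelic) =
        ((heisChart hc ((0 : AdeleRing (𝓞 E) E),
            smulTraceZero ((diagUnit B.2 0)⁻¹ * diagUnit B.2 2) hfix w') : adelicUnipotent F E c 3) :
          (quasiSplit F E c 3).Adelic) := by
    intro w'
    have h := torus_unipotent_inv_mul_center_mul hc t u hd w'
    rw [← hbtu] at h
    exact h
  symm
  rw [← e.tsum_eq]
  refine tsum_congr fun w => congrArg G ?_
  rw [conj_mul_of_central (coe_center_mul_comm ζ hz₁), he w, hconj]

end Invariance

/-! ## §2 (K-torus) The torus dilates the centre variable; the dilation read on the line `𝔸_F · δ` -/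

section Torus

variable {M : Type*} [AddCommMonoid M] [TopologicalSpace M]

/-- **THE TORUS DILATES THE CENTRE VARIABLE**: for `t = diag(d) ∈ T(𝔸_F)` and `g ∈ G(𝔸_F)`,
`Σ'_{w ≠ 0} G((t g)⁻¹ (z₁ n(w)) (t g)) = Σ'_{w ≠ 0} G(g⁻¹ (z₁ n(a_t · w)) g)`, `a_t = d₀⁻¹ d₂` (★
`torus_inv_mul_center_mul_torus`; `z₁` central) — Rogawski's «`M` acts on `n(w)` through `α₃(m)⁻¹`».
[cite: Rogawski1990, §7.3 Prop. 7.3.2 (pp. 96–97)] [cite: Rogawski1990, §7.2 (p. 94)] -/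
theorem tsum_centre_conj_torus_mul (hc : c * c = 1)
    (hz₁ : (z₁ : (quasiSplit F E c 3).Adelic) =
      (quasiSplit F E c 3).toAdelic (ratCenter F E c 3 ((StdForm.antidiagonal 3).over E) ζ))
    (G : (quasiSplit F E c 3).Adelic → M) (t : torusInBorel F E c 3) {d : Fin 3 → (AdeleRing (𝓞 E) E)ˣ}
    (hd : glDiagonal 3 (AdeleRing (𝓞 E) E) d =
      adelicVal F E c 3 _ ((t : borelAdelic F E c 3) : (quasiSplit F E c 3).Adelic))
    (g : (quasiSplit F E c 3).Adelic) :
    (∑' w : {w : rationalTraceZero F E c // w ≠ 0},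
      G ((((t : borelAdelic F E c 3) : (quasiSplit F E c 3).Adelic) * g)⁻¹ *
        ((z₁ : (quasiSplit F E c 3).Adelic) *
          ((heisChart hc ((0 : AdeleRing (𝓞 E) E), ((w.1 : rationalTraceZero F E c) : traceZeroAdele F E c)) :
            adelicUnipotent F E c 3) : (quasiSplit F E c 3).Adelic)) *
        ((((t : borelAdelic F E c 3) : (quasiSplit F E c 3).Adelic)) * g))) =
      ∑' w : {w : rationalTraceZero F E c // w ≠ 0},
        G (g⁻¹ * ((z₁ : (quasiSplit F E c 3).Adelic) *
          ((heisChart hc ((0 : AdeleRing (𝓞 E) E),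
              smulTraceZero ((d 0)⁻¹ * d 2) (conjAdele_torusCentralScalar t hd)
                ((w.1 : rationalTraceZero F E c) : traceZeroAdele F E c)) :
            adelicUnipotent F E c 3) : (quasiSplit F E c 3).Adelic)) * g) := by
  refine tsum_congr fun w => congrArg G ?_
  rw [conj_mul_of_central (coe_center_mul_comm ζ hz₁), coe_heisChart, coe_heisChart,
    torus_inv_mul_center_mul_torus hc t hd]

variable [Algebra.IsQuadraticExtension F E] {δ : E}

/-- **The centre character is the inverse norm of the first diagonal entry**: for `t = diag(d) ∈ T(𝔸_F)` of the
quasi-split `U(3)` of a QUADRATIC `E/F`, `d₀⁻¹ d₂ = ((N_{E/F} d₀)⁻¹ ⊗ 1)` — the torus relation `c(d₀) d₂ = 1` (★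
`torus_relations`) and `(N y)_E = y · c y` (★ `AdeleRing.ideleBaseChange_ideleRelNorm`, ★
`ideleGalNorm_eq_mul_smul_of_apply_eq_neg`). Rogawski: `α₃(m)⁻¹ = N(a)⁻¹` for `m = d(a, b, ā⁻¹)`.
[cite: Rogawski1990, §7.2 (p. 94)] [cite: CasselsFrohlichANT1967, Ch. VII §2] -/
theorem inv_mul_diagUnit_two_eq_ideleBaseChange (hcδ : c δ = -δ) (hδ : δ ≠ 0) (t : torusInBorel F E c 3)
    {d : Fin 3 → (AdeleRing (𝓞 E) E)ˣ}
    (hd : glDiagonal 3 (AdeleRing (𝓞 E) E) d =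
      adelicVal F E c 3 _ ((t : borelAdelic F E c 3) : (quasiSplit F E c 3).Adelic)) :
    (d 0)⁻¹ * d 2 = AdeleRing.ideleBaseChange F E (AdeleRing.ideleRelNorm F E (d 0))⁻¹ := by
  obtain ⟨-, -, h02⟩ := torus_relations t hd
  have h2 : d 2 = (c • d 0)⁻¹ := by
    refine eq_inv_of_mul_eq_one_right (Units.ext ?_)
    rw [Units.val_mul, val_smul_eq_conjAdele, Units.val_one]
    exact h02
  rw [h2, map_inv, AdeleRing.ideleBaseChange_ideleRelNorm, ideleGalNorm_eq_mul_smul_of_apply_eq_neg c hcδ hδ,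
    ← _root_.mul_inv_rev, mul_comm (c • d 0)]

/-- The dilation by `d₀⁻¹ d₂` read on the line: `a_t · θ(x) = θ((N d₀)⁻¹ · x)` for every adele `x` of `F`
(`θ(x) = (x ⊗ 1) δ`, ★ `coe_traceZeroLine_mul`). [cite: Rogawski1990, §7.2 (p. 94)] -/
theorem smulTraceZero_torus_traceZeroLine (hcδ : c δ = -δ) (hδ : δ ≠ 0) (t : torusInBorel F E c 3)
    {d : Fin 3 → (AdeleRing (𝓞 E) E)ˣ}
    (hd : glDiagonal 3 (AdeleRing (𝓞 E) E) d =
      adelicVal F E c 3 _ ((t : borelAdelic F E c 3) : (quasiSplit F E c 3).Adelic))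
    (x : AdeleRing (𝓞 F) F) :
    smulTraceZero ((d 0)⁻¹ * d 2) (conjAdele_torusCentralScalar t hd) (traceZeroLine F E c hcδ hδ x) =
      traceZeroLine F E c hcδ hδ
        ((((AdeleRing.ideleRelNorm F E (d 0))⁻¹ : (AdeleRing (𝓞 F) F)ˣ) : AdeleRing (𝓞 F) F) * x) := by
  refine Subtype.ext ?_
  rw [coe_smulTraceZero, inv_mul_diagUnit_two_eq_ideleBaseChange hcδ hδ t hd, AdeleRing.coe_ideleBaseChange,
    coe_traceZeroLine_mul]

/-- **THE CENTRE LATTICE SUM ALONG THE TORUS AS A LATTICE SUM OVER `F^*` IN THE NORM `N(d₀ t)`**: for `E/F`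
quadratic with `c δ = -δ ≠ 0`, `t ∈ T(𝔸_F)`, `g ∈ G(𝔸_F)` and every `G`,
`Σ'_{w ∈ E⁻, w ≠ 0} G((t g)⁻¹ (z₁ n(w)) (t g)) = Σ'_{k ∈ F^*} G(g⁻¹ (z₁ n(θ((k · N(d₀ t))⁻¹))) g)`
(`E⁻ ∖ 0 = θ(F^*)` ★ `unitsEquivRationalTraceZeroNeZero`; `F^* ≅ principalIdeles F` ★ `principalIdelesEquiv`, composed with
inversion; `d₀ t = diagUnit (↑t).2 0`, `N = AdeleRing.ideleRelNorm F E`) — the summand is a function of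
`k • N(d₀ t)`, the shape ★ (C-P) `exists_push_and_integral_tsum_comp_ideleRelNorm_diagUnitZero_eq` integrates.
[cite: Rogawski1990, §7.3 (7.3.2)–(7.3.3) (pp. 96–97)] [cite: Rogawski1990, §7.2 (p. 94)] -/
theorem tsum_centre_conj_torus_mul_eq_tsum_principalIdeles (hc : c * c = 1) (hcδ : c δ = -δ) (hδ : δ ≠ 0)
    (hz₁ : (z₁ : (quasiSplit F E c 3).Adelic) =
      (quasiSplit F E c 3).toAdelic (ratCenter F E c 3 ((StdForm.antidiagonal 3).over E) ζ))
    (G : (quasiSplit F E c 3).Adelic → M) (t : torusInBorel F E c 3) (g : (quasiSplit F E c 3).Adelic) :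
    (∑' w : {w : rationalTraceZero F E c // w ≠ 0},
      G ((((t : borelAdelic F E c 3) : (quasiSplit F E c 3).Adelic) * g)⁻¹ *
        ((z₁ : (quasiSplit F E c 3).Adelic) *
          ((heisChart hc ((0 : AdeleRing (𝓞 E) E), ((w.1 : rationalTraceZero F E c) : traceZeroAdele F E c)) :
            adelicUnipotent F E c 3) : (quasiSplit F E c 3).Adelic)) *
        ((((t : borelAdelic F E c 3) : (quasiSplit F E c 3).Adelic)) * g))) =
      ∑' k : GaloisRepresentations.principalIdeles F,
        G (g⁻¹ * ((z₁ : (quasiSplit F E c 3).Adelic) *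
          ((heisChart hc ((0 : AdeleRing (𝓞 E) E),
              traceZeroLine F E c hcδ hδ
                (((k • AdeleRing.ideleRelNorm F E (diagUnit (t : borelAdelic F E c 3).2 0))⁻¹ :
                  (AdeleRing (𝓞 F) F)ˣ) : AdeleRing (𝓞 F) F)) :
            adelicUnipotent F E c 3) : (quasiSplit F E c 3).Adelic)) * g) := by
  have hd := glDiagonal_diagUnit_torus (F := F) (E := E) (c := c) t
  rw [tsum_centre_conj_torus_mul ζ hc hz₁ G t hd g]
  -- `F^* ≃ principalIdeles F`, composed with inversion
  let e' : Fˣ ≃ GaloisRepresentations.principalIdeles F := (Equiv.inv Fˣ).trans (principalIdelesEquiv F).toEquiv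
  have he' : ∀ ξ : Fˣ, ((((e' ξ : GaloisRepresentations.principalIdeles F) •
      AdeleRing.ideleRelNorm F E (diagUnit (t : borelAdelic F E c 3).2 0))⁻¹ : (AdeleRing (𝓞 F) F)ˣ) : AdeleRing (𝓞 F) F) =
      (((AdeleRing.ideleRelNorm F E (diagUnit (t : borelAdelic F E c 3).2 0))⁻¹ : (AdeleRing (𝓞 F) F)ˣ) :
          AdeleRing (𝓞 F) F) * algebraMap F (AdeleRing (𝓞 F) F) (ξ : F) := by
    intro ξ
    have h1 : ((e' ξ : GaloisRepresentations.principalIdeles F) : (AdeleRing (𝓞 F) F)ˣ) =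
        GaloisRepresentations.principalIdele F ξ⁻¹ := rfl
    rw [Subgroup.smul_def, smul_eq_mul, h1, _root_.mul_inv_rev, ← map_inv (GaloisRepresentations.principalIdele F),
      inv_inv, Units.val_mul]
    rfl
  rw [← e'.tsum_eq, ← (unitsEquivRationalTraceZeroNeZero F E c hcδ hδ).tsum_eq]
  refine tsum_congr fun ξ => congrArg G ?_
  rw [coe_unitsEquivRationalTraceZeroNeZero, smulTraceZero_torus_traceZeroLine hcδ hδ t hd, he']

end Torus

/-! ## §3 (K4) The modulus of the Borel on the torus is the squared norm of `N(d₀ t)` -/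

section Modulus

variable [Algebra.IsQuadraticExtension F E]

/-- **`‖N_{E/F} y‖_F = ‖y‖_E`** for a quadratic `E/F` (`‖(N y) ⊗ 1‖_E = ‖N y‖_F²` ★ `ideleNorm_ideleBaseChange`,
`(N y)_E = ∏_σ σ y` and `‖∏_σ σ y‖ = ‖y‖²` ★ `ideleNorm_ideleGalNorm`). [cite: CasselsFrohlichANT1967, Ch. II §11] -/
theorem ideleNorm_ideleRelNorm_quadratic (y : (AdeleRing (𝓞 E) E)ˣ) :
    IdeleClassGroup.ideleNorm F (AdeleRing.ideleRelNorm F E y) = IdeleClassGroup.ideleNorm E y := by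
  have h := Literature.NumberTheory.AdelicBaseChange.ideleNorm_ideleBaseChange (K := F) (L := E)
    (AdeleRing.ideleRelNorm F E y)
  rw [AdeleRing.ideleBaseChange_ideleRelNorm, ideleNorm_ideleGalNorm, ← Nat.card_eq_fintype_card,
    IsGalois.card_aut_eq_finrank, Algebra.IsQuadraticExtension.finrank_eq_two F E] at h
  exact ((pow_left_inj₀ zero_le zero_le two_ne_zero).1 h).symm

/-- **`δ_B(t) = ‖N(d₀ t)‖_F²`** on the torus of the quasi-split `U(3)` of a quadratic `E/F`: the root modulus
`torusRootModulus E 3 (diagUnit (↑t).2)` (= the modular character of `B(𝔸_F)` at `t`, ★ `modularCharacter_borelAdelic_torus`)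
is `‖d₀‖_E² = ‖N d₀‖_F²` (★ `torusRootModulus_three_eq`, Tate's Lemma 4.1.2 ★ `AdeleRing.distribHaarChar_eq_ideleNorm`).
Rogawski: `δ_B(d(a, b, ā⁻¹)) = ‖a‖²`. [cite: Rogawski1990, §2.2 (p. 13)] [cite: CasselsFrohlichANT1967, Ch. XV Lemma 4.1.2] -/
theorem torusRootModulus_diagUnit_eq_ideleNorm_ideleRelNorm_sq [LocallyCompactSpace (AdeleRing (𝓞 E) E)]
    (t : torusInBorel F E c 3) :
    torusRootModulus E 3 (diagUnit (t : borelAdelic F E c 3).2) =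
      IdeleClassGroup.ideleNorm F (AdeleRing.ideleRelNorm F E (diagUnit (t : borelAdelic F E c 3).2 0)) ^ 2 := by
  rw [torusRootModulus_three_eq t (glDiagonal_diagUnit_torus t), AdeleRing.distribHaarChar_eq_ideleNorm,
    ideleNorm_ideleRelNorm_quadratic (F := F) (E := E), pow_two]

end Modulus

end UnitaryGroup

end Literature.NumberTheory.Automorphic

end
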